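import Summits.BirchSwinnertonDyer.BirchSwinnertonDyer.Theorems.ManinLocalTwoThreeEtaIdentityReductionThirtySix
import HarnessLib

/-!
# Level 24 (non-CM, `4 ∣ 24`): the newform is `η(2τ)η(4τ)η(6τ)η(12τ)`, and the `η`-identities of `X₀(24) = 24a1`
# reduce to three `q`-asymptotics at `i∞`

Cell bsd-f2-manin, route `ManinLocalTwoThree` (crux C2 `ManinOddAtFour` stmt-22967: `2² ∣ 24`), prover seat p2 gen 26; level-`24`
twin of `NewformThirtySix` + `EtaIdentityReductionThirtySix`, for -an g50's §95 NÉRON SQUEEZE (the non-CM replacement of the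
hexagonal/Gaussian squeeze: `Λ_W = c·Λ_f` and `Λ_f ⊆ Λ_{W₀}` for a globally minimal `W₀` force `1/c ∈ ℤ` by the tree's PROVED
`integral_neronScaling_of_isGloballyMinimal_holds`).

OBJECTS (tree `etaQuotient 24 (expFn …)`; found by solving Ligozat's cusp-order system at `24`, seat folder `scripts/etasearch24.py`,
certified in exact arithmetic to `O(q⁷⁰)`, `scripts/rel24.py`): `x = η(6τ)³η(8τ)/(η(2τ)η(24τ)³) = q⁻² + 1 + 2q² + …`,
`y = η(4τ)η(8τ)²η(12τ)⁵/(η(2τ)η(6τ)η(24τ)⁶) = q⁻³ + q⁻¹ + q + 3q³ + …`, `φ₂₄ = η(2τ)η(4τ)η(6τ)η(12τ)` (tree `cuspFormEta24`).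
IDENTITIES: **`y² = x³ − x² − 4x + 4`** — LITERALLY Cremona's `24a1 = [0, −1, 0, −4, 4]` (`c₄ = 208`, `c₆ = −2240`, `Δ = 2⁸3²`) — and
`x′ = −2πi φ₂₄ · 2y`, `y′ = −2πi φ₂₄ · (3x² − 2x − 4)`; with `X = x − ⅓`: `(X′)² = (2πiφ₂₄)²(4X³ − (52/3)X + 280/27)`.

* §1 FACT-FREE: `a₁(φ₂₄) = 1`, every form of level `24` is new and Hecke-eigen, `IsNewform0 φ₂₄`, **`D.f = φ₂₄` for every `X₀(24)`-datum**,
  `S/q → 0 ⟹ S = 0` on `S₂(Γ₀(24)) = ℂφ₂₄` (tree `cuspForm_two_eq_smul_eta_14_15_24`).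
* §2 `x, y` are `Γ₀(24)`-invariant (Newman) and bounded at every cusp off `∞` (Ligozat orders `0,0,72,0,288,0,0` / `0,0,0,192,0,192,576`).
* §3 (T1) `((2πi)⁻¹x′ + φ₂₄·2y)/q → 0`, (T2) `((2πi)⁻¹y′ + φ₂₄(3x² − 2x − 4))/q → 0`, (T3) `x³ − x² − 4x + 4 − y² → 0` ⟹ the identities
  (the general-`N` cusp-form argument `EtaIdentityReductionThirtySix.deriv_eq_of_tendsto_of`) ⟹ **(S2)₂₄ `Λ(φ₂₄) ⊆ Λ(52/3, −280/27)`**, the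
  Néron lattice shape of `24a1` (analytic bridge on `X = x − ⅓`).  The limits themselves are the sequel `…LigozatIdentitiesTwentyFour`.

HONEST FRAMING: unconditional; the only hypotheses are (T1)–(T3).  Nothing here proves C2, Manin's conjecture or BSD.  No definition,
no named fact, no sorry. [cite: Ligozat1975, Ch. 3–4] [cite: CremonaAlgorithms1997, Table 1 (24a1), Table 3, §2.10] [cite: DiamondShurman2005, Thm. 3.5.1]
-/

set_option autoImplicit false
-- lint-debt: the directory name repeats the summit name (sibling precedent `ManinLocalTwoThreeEtaIdentityReductionThirtySix.lean`)
set_option linter.dupNamespace false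

noncomputable section

open Complex Filter Topology Set Function Asymptotics
open UpperHalfPlane hiding I
open scoped Real Topology Manifold MatrixGroups ModularForm
open ModularForm CongruenceSubgroup
open Literature.NumberTheory.EllipticCurves Literature.NumberTheory.EllipticCurves.ModularForms

namespace Summit.BirchSwinnertonDyer.BirchSwinnertonDyer.Theorems.ManinLocalTwoThree.EtaIdentityReductionTwentyFour

open CuspToolkit AnalyticBridge EtaIdentityReductionThirtySix

/-! ## §1 FACT-FREE: the newform at level `24` is `φ₂₄ = η(2τ)η(4τ)η(6τ)η(12τ)` -/

/-- `φ₂₄ ≠ 0`. [folklore] -/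
theorem cuspFormEta24_ne_zero : cuspFormEta24 ≠ 0 := etaQuotientCuspForm_ne_zero _ _ _ _ _ _

/-- `φ₂₄(τ)/q → 1` at `i∞` (order `(2 + 4 + 6 + 12)/24 = 1`). [cite: Koehler2011, §1] -/
theorem tendsto_eta24_div_qParam :
    Tendsto (fun τ : ℍ ↦ cuspFormEta24 τ / Periodic.qParam 1 (τ : ℂ)) atImInfty (𝓝 1) := by
  have h := tendsto_etaQuotient_div_qParam_zpow 24 (expFn etaList24) 1 (by decide)
  refine h.congr fun τ ↦ ?_
  rw [zpow_one, coe_cuspFormEta_14_15_24.2.2]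

/-- `a₁(φ₂₄) = 1`. [cite: CremonaAlgorithms1997, Table 3 (N = 24)] -/
theorem cuspCoeff_one_eta24 : cuspCoeff cuspFormEta24 1 = 1 :=
  NonVacuityTwentySeven.cuspCoeff_one_eq_of_tendsto _ tendsto_eta24_div_qParam

/-- `S₂(Γ₀(M)) = 0` for every proper divisor `M` of `24` (`M ∈ {1, 2, 3, 4, 6, 8, 12}`, genus `0`). [cite: DiamondShurman2005, Thm. 3.5.1] -/
theorem cuspForm_two_eq_zero_of_mem_properDivisors_twentyFour {M : ℕ} [NeZero M]
    (hM : M ∈ Nat.properDivisors 24) (g : CuspForm (Gamma0 M) 2) : g = 0 := by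
  have hfd : FiniteDimensional ℂ (CuspForm (Gamma0 M) 2) := finiteDimensional_cuspForm_gamma0 M 2
  rw [show Nat.properDivisors 24 = {1, 2, 3, 4, 6, 8, 12} by decide] at hM
  simp only [Finset.mem_insert, Finset.mem_singleton] at hM
  have h1 : finrank_cuspForm_two_eq_genusX0 M :=
    finrank_cuspForm_two_eq_genusX0_of_mem_levels₂ (by simp only [Finset.mem_insert, Finset.mem_singleton]; omega)
  have h2 : genusX0 M = 0 :=
    genusX0_eq_zero_of_mem_genusZeroLevels (by simp only [Finset.mem_insert, Finset.mem_singleton]; omega)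
  unfold finrank_cuspForm_two_eq_genusX0 at h1
  rw [h2] at h1
  exact (finrank_zero_iff_forall_zero.mp h1) g

/-- Every weight-`2` cusp form of level `24` is new. [cite: DiamondShurman2005, §5.6] -/
theorem mem_newSubspace0_twentyFour (f : CuspForm (Gamma0 24) 2) : f ∈ newSubspace0 24 2 := by
  rw [newSubspace0, Submodule.mem_iInf]
  intro Md
  rw [LinearMap.mem_ker]
  exact cuspForm_two_eq_zero_of_mem_properDivisors_twentyFour Md.2.1 _

/-- Every non-zero `f ∈ S₂(Γ₀(24)) = ℂφ₂₄` is a Hecke eigenform. [cite: DiamondShurman2005, Prop. 5.8.4] -/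
theorem isHeckeEigenform_of_ne_zero_twentyFour {f : CuspForm (Gamma0 24) 2} (hf : f ≠ 0) : IsHeckeEigenform f := by
  intro p hp
  haveI : NeZero p := ⟨hp.ne_zero⟩
  obtain ⟨a, ha⟩ := cuspForm_two_eq_smul_eta_14_15_24.2.2 f
  obtain ⟨b, hb⟩ := cuspForm_two_eq_smul_eta_14_15_24.2.2 (heckeT _ 2 p f)
  have ha0 : a ≠ 0 := by rintro rfl; exact hf (by rw [← ha, zero_smul])
  refine ⟨b / a, ?_⟩
  rw [← hb, ← ha, smul_smul, div_mul_cancel₀ b ha0]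

/-- `φ₂₄` is a newform of weight `2` on `Γ₀(24)` — FACT-FREE. [cite: CremonaAlgorithms1997, Table 3 (N = 24)] -/
theorem isNewform0_eta24 : IsNewform0 cuspFormEta24 :=
  ⟨mem_newSubspace0_twentyFour _, isHeckeEigenform_of_ne_zero_twentyFour cuspFormEta24_ne_zero, cuspCoeff_one_eta24⟩

/-- Uniqueness: every newform of weight `2` on `Γ₀(24)` is `φ₂₄`. [cite: CremonaAlgorithms1997, Table 3 (N = 24)] -/
theorem eq_eta24_of_isNewform0 {g : CuspForm (Gamma0 24) 2} (hg : IsNewform0 g) : g = cuspFormEta24 := by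
  obtain ⟨c, hc⟩ := cuspForm_two_eq_smul_eta_14_15_24.2.2 g
  have h1 : cuspCoeff g 1 = 1 := hg.2.2
  have hc1 : c = 1 := by
    have h := congrArg (cuspCoeff · 1) hc
    simp only [cuspCoeff_smul, h1, cuspCoeff_one_eta24, mul_one] at h
    exact h
  rw [← hc, hc1, one_smul]

/-- **Every `X₀(24)`-datum of every curve has newform `φ₂₄`.** FACT-FREE. [cite: CremonaAlgorithms1997, Table 3 (N = 24)] -/
theorem f_eq_eta24 {W : WeierstrassCurve ℚ} (D : ModularParametrizationData W 24) : D.f = cuspFormEta24 :=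
  eq_eta24_of_isNewform0 D.isNewformOf.1

/-- `S ∈ S₂(Γ₀(24))` with `S/q → 0` at `i∞` vanishes. [folklore] -/
theorem cuspForm_twentyFour_eq_zero_of_tendsto (S : CuspForm (Gamma0 24) 2)
    (h : Tendsto (fun τ : ℍ ↦ S τ / Periodic.qParam 1 (τ : ℂ)) atImInfty (𝓝 0)) : S = 0 := by
  obtain ⟨c, hc⟩ := cuspForm_two_eq_smul_eta_14_15_24.2.2 S
  have hlim : Tendsto (fun τ : ℍ ↦ S τ / Periodic.qParam 1 (τ : ℂ)) atImInfty (𝓝 c) := by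
    have := tendsto_eta24_div_qParam.const_mul c
    rw [mul_one] at this
    refine this.congr fun τ ↦ ?_
    rw [← hc, CuspForm.IsGLPos.smul_apply, smul_eq_mul, mul_div_assoc]
  have hc0 : c = 0 := tendsto_nhds_unique hlim h
  rw [← hc, hc0, zero_smul]

/-! ## §2 `x, y` are `Γ₀(24)`-invariant and bounded at every cusp off `∞` -/

/-- Newman's conditions for `x = η₂⁻¹η₆³η₈η₂₄⁻³` in weight `0` (`∏ δ^{|r|} = 2·6³·8·24³ = 6912²`). [folklore] -/
theorem newmanCond_x24 : NewmanCond 24 (expFn [(2, -1), (6, 3), (8, 1), (24, -3)]) 0 :=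
  ⟨by decide, by decide, by decide, ⟨6912, by decide⟩⟩

/-- Newman's conditions for `y = η₂⁻¹η₄η₆⁻¹η₈²η₁₂⁵η₂₄⁻⁶` in weight `0` (`∏ δ^{|r|} = 2³⁸3¹² = (2¹⁹3⁶)²`). [folklore] -/
theorem newmanCond_y24 : NewmanCond 24 (expFn [(2, -1), (4, 1), (6, -1), (8, 2), (12, 5), (24, -6)]) 0 :=
  ⟨by decide, by decide, by decide, ⟨2 ^ 19 * 3 ^ 6, by decide⟩⟩

/-- `x(γτ) = x(τ)` for `γ ∈ Γ₀(24)`. [folklore] -/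
theorem x24_smul (γ : Gamma0 24) (τ : ℍ) :
    etaQuotient 24 (expFn [(2, -1), (6, 3), (8, 1), (24, -3)]) ((γ : SL(2, ℤ)) • τ)
      = etaQuotient 24 (expFn [(2, -1), (6, 3), (8, 1), (24, -3)]) τ := by
  have h := etaQuotient_smul_of_mem_Gamma0 24 (by norm_num) _ 0 ⟨0, by simp⟩ newmanCond_x24 γ.2 τ
  rwa [zpow_zero, one_mul] at h

/-- `y(γτ) = y(τ)` for `γ ∈ Γ₀(24)`. [folklore] -/
theorem y24_smul (γ : Gamma0 24) (τ : ℍ) :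
    etaQuotient 24 (expFn [(2, -1), (4, 1), (6, -1), (8, 2), (12, 5), (24, -6)]) ((γ : SL(2, ℤ)) • τ)
      = etaQuotient 24 (expFn [(2, -1), (4, 1), (6, -1), (8, 2), (12, 5), (24, -6)]) τ := by
  have h := etaQuotient_smul_of_mem_Gamma0 24 (by norm_num) _ 0 ⟨0, by simp⟩ newmanCond_y24 γ.2 τ
  rwa [zpow_zero, one_mul] at h

/-- Ligozat's order at level `24` is `≥ 0` at every `c` with `24 ∤ c`, given the values at the proper divisors. [cite: Ligozat1975, Ch. 3] -/
theorem cuspOrder24_nonneg_of_not_dvd24 (r : ℕ → ℤ)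
    (h : ∀ t ∈ Nat.divisors 24, t ≠ 24 → 0 ≤ cuspOrder24 24 r t) {c : ℤ} (hc : ¬ (24 : ℤ) ∣ c) :
    0 ≤ cuspOrder24 24 r c := by
  rw [cuspOrder24_eq_gcd]
  refine h _ (Nat.mem_divisors.mpr ⟨Nat.gcd_dvd_left _ _, by norm_num⟩) fun h24 ↦ hc ?_
  have h24' : (24 : ℕ) ∣ c.natAbs := h24 ▸ Nat.gcd_dvd_right _ _
  exact Int.natCast_dvd.mpr h24'

/-- `γ ∉ Γ₀(24)` ⟹ `24 ∤ c(γ)`. [folklore] -/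
theorem not_dvd_of_not_mem24 {γ : SL(2, ℤ)} (hγ : γ ∉ Gamma0 24) : ¬ (24 : ℤ) ∣ γ 1 0 := by
  intro h
  apply hγ
  rw [Gamma0_mem]
  exact (ZMod.intCast_zmod_eq_zero_iff_dvd _ 24).mpr h

/-- `x ∘ γ` is bounded at `i∞` for `γ ∉ Γ₀(24)` (Ligozat orders `0,0,72,0,288,0,0`). [cite: Ligozat1975, Ch. 3] -/
theorem isBoundedAtImInfty_x24_smul {γ : SL(2, ℤ)} (hγ : γ ∉ Gamma0 24) :
    IsBoundedAtImInfty (fun τ : ℍ ↦ etaQuotient 24 (expFn [(2, -1), (6, 3), (8, 1), (24, -3)]) (γ • τ)) :=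
  isBoundedAtImInfty_etaQuotient_smul 24 (by norm_num) _ (by decide) γ
    (cuspOrder24_nonneg_of_not_dvd24 _ (by decide) (not_dvd_of_not_mem24 hγ))

/-- `y ∘ γ` is bounded at `i∞` for `γ ∉ Γ₀(24)` (Ligozat orders `0,0,0,192,0,192,576`). [cite: Ligozat1975, Ch. 3] -/
theorem isBoundedAtImInfty_y24_smul {γ : SL(2, ℤ)} (hγ : γ ∉ Gamma0 24) :
    IsBoundedAtImInfty (fun τ : ℍ ↦ etaQuotient 24 (expFn [(2, -1), (4, 1), (6, -1), (8, 2), (12, 5), (24, -6)]) (γ • τ)) :=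
  isBoundedAtImInfty_etaQuotient_smul 24 (by norm_num) _ (by decide) γ
    (cuspOrder24_nonneg_of_not_dvd24 _ (by decide) (not_dvd_of_not_mem24 hγ))

/-! ## §3 The three limits ⟹ the identities ⟹ (S2)₂₄ -/

/-- **(I2a) from (T1)**: `x′ = −2πi φ₂₄ · 2y` on `ℍ`. [cite: Ligozat1975, Ch. 4] -/
theorem deriv_x24_of_tendsto
    (hT1 : Tendsto (fun τ : ℍ ↦ ((2 * π * I)⁻¹
      * deriv (etaQuotient 24 (expFn [(2, -1), (6, 3), (8, 1), (24, -3)]) ∘ ofComplex) τ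
      + cuspFormEta24 τ * (2 * etaQuotient 24 (expFn [(2, -1), (4, 1), (6, -1), (8, 2), (12, 5), (24, -6)]) τ))
      / Function.Periodic.qParam 1 (τ : ℂ)) atImInfty (𝓝 0)) :
    ∀ τ : ℍ, deriv (etaQuotient 24 (expFn [(2, -1), (6, 3), (8, 1), (24, -3)]) ∘ ofComplex) τ
      = -(2 * π * I * cuspFormEta24 τ)
          * (2 * etaQuotient 24 (expFn [(2, -1), (4, 1), (6, -1), (8, 2), (12, 5), (24, -6)]) τ) := by
  refine deriv_eq_of_tendsto_of cuspFormEta24 cuspForm_twentyFour_eq_zero_of_tendsto _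
    (fun τ ↦ 2 * etaQuotient 24 (expFn [(2, -1), (4, 1), (6, -1), (8, 2), (12, 5), (24, -6)]) τ)
    (mdifferentiable_etaQuotient 24 _) ?_ (fun γ hγ τ ↦ x24_smul ⟨γ, hγ⟩ τ)
    (fun γ hγ τ ↦ by simp only [y24_smul ⟨γ, hγ⟩ τ])
    (fun γ hγ ↦ isBoundedAtImInfty_x24_smul hγ) (fun γ hγ ↦ ?_) hT1
  · exact (mdifferentiable_etaQuotient 24 _).const_smul (2 : ℂ)
  · exact (isBoundedAtImInfty_y24_smul hγ).const_mul_left 2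

/-- **(I2b) from (T2)**: `y′ = −2πi φ₂₄ · (3x² − 2x − 4)` on `ℍ`. [cite: Ligozat1975, Ch. 4] -/
theorem deriv_y24_of_tendsto
    (hT2 : Tendsto (fun τ : ℍ ↦ ((2 * π * I)⁻¹
      * deriv (etaQuotient 24 (expFn [(2, -1), (4, 1), (6, -1), (8, 2), (12, 5), (24, -6)]) ∘ ofComplex) τ
      + cuspFormEta24 τ * (3 * etaQuotient 24 (expFn [(2, -1), (6, 3), (8, 1), (24, -3)]) τ ^ 2
        - 2 * etaQuotient 24 (expFn [(2, -1), (6, 3), (8, 1), (24, -3)]) τ - 4))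
      / Function.Periodic.qParam 1 (τ : ℂ)) atImInfty (𝓝 0)) :
    ∀ τ : ℍ, deriv (etaQuotient 24 (expFn [(2, -1), (4, 1), (6, -1), (8, 2), (12, 5), (24, -6)]) ∘ ofComplex) τ
      = -(2 * π * I * cuspFormEta24 τ)
          * (3 * etaQuotient 24 (expFn [(2, -1), (6, 3), (8, 1), (24, -3)]) τ ^ 2
            - 2 * etaQuotient 24 (expFn [(2, -1), (6, 3), (8, 1), (24, -3)]) τ - 4) := by
  refine deriv_eq_of_tendsto_of cuspFormEta24 cuspForm_twentyFour_eq_zero_of_tendsto _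
    (fun τ ↦ 3 * etaQuotient 24 (expFn [(2, -1), (6, 3), (8, 1), (24, -3)]) τ ^ 2
      - 2 * etaQuotient 24 (expFn [(2, -1), (6, 3), (8, 1), (24, -3)]) τ - 4)
    (mdifferentiable_etaQuotient 24 _) ?_ (fun γ hγ τ ↦ y24_smul ⟨γ, hγ⟩ τ)
    (fun γ hγ τ ↦ by simp only [x24_smul ⟨γ, hγ⟩ τ])
    (fun γ hγ ↦ isBoundedAtImInfty_y24_smul hγ) (fun γ hγ ↦ ?_) hT2
  · exact ((((mdifferentiable_etaQuotient 24 _).pow 2).const_smul (3 : ℂ)).sub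
      ((mdifferentiable_etaQuotient 24 _).const_smul (2 : ℂ))).sub mdifferentiable_const
  · exact ((((isBoundedAtImInfty_x24_smul hγ).mul (isBoundedAtImInfty_x24_smul hγ)).const_mul_left 3 |>.sub
      ((isBoundedAtImInfty_x24_smul hγ).const_mul_left 2)).sub (const_boundedAtFilter atImInfty (4 : ℂ))).congr_left
      fun τ ↦ by simp only [Pi.mul_apply, Function.const_apply]; ring

/-- **(I1) from (I2a), (I2b), (T3)**: `x³ − x² − 4x + 4 = y²` on `ℍ` (the derivative of the cubic vanishes identically and it tends to `0`).
[cite: Ligozat1975, Ch. 4] -/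
theorem cubic24_of_deriv
    (hx : ∀ τ : ℍ, deriv (etaQuotient 24 (expFn [(2, -1), (6, 3), (8, 1), (24, -3)]) ∘ ofComplex) τ
      = -(2 * π * I * cuspFormEta24 τ)
          * (2 * etaQuotient 24 (expFn [(2, -1), (4, 1), (6, -1), (8, 2), (12, 5), (24, -6)]) τ))
    (hy : ∀ τ : ℍ, deriv (etaQuotient 24 (expFn [(2, -1), (4, 1), (6, -1), (8, 2), (12, 5), (24, -6)]) ∘ ofComplex) τ
      = -(2 * π * I * cuspFormEta24 τ)
          * (3 * etaQuotient 24 (expFn [(2, -1), (6, 3), (8, 1), (24, -3)]) τ ^ 2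
            - 2 * etaQuotient 24 (expFn [(2, -1), (6, 3), (8, 1), (24, -3)]) τ - 4))
    (hT3 : Tendsto (fun τ : ℍ ↦ etaQuotient 24 (expFn [(2, -1), (6, 3), (8, 1), (24, -3)]) τ ^ 3
      - etaQuotient 24 (expFn [(2, -1), (6, 3), (8, 1), (24, -3)]) τ ^ 2
      - 4 * etaQuotient 24 (expFn [(2, -1), (6, 3), (8, 1), (24, -3)]) τ + 4
      - etaQuotient 24 (expFn [(2, -1), (4, 1), (6, -1), (8, 2), (12, 5), (24, -6)]) τ ^ 2) atImInfty (𝓝 0)) :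
    ∀ τ : ℍ, etaQuotient 24 (expFn [(2, -1), (6, 3), (8, 1), (24, -3)]) τ ^ 3
      - etaQuotient 24 (expFn [(2, -1), (6, 3), (8, 1), (24, -3)]) τ ^ 2
      - 4 * etaQuotient 24 (expFn [(2, -1), (6, 3), (8, 1), (24, -3)]) τ + 4
      = etaQuotient 24 (expFn [(2, -1), (4, 1), (6, -1), (8, 2), (12, 5), (24, -6)]) τ ^ 2 := by
  set X : ℍ → ℂ := etaQuotient 24 (expFn [(2, -1), (6, 3), (8, 1), (24, -3)]) with hX
  set Y : ℍ → ℂ := etaQuotient 24 (expFn [(2, -1), (4, 1), (6, -1), (8, 2), (12, 5), (24, -6)]) with hY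
  have hXd := UpperHalfPlane.mdifferentiable_iff.mp (mdifferentiable_etaQuotient 24 (expFn [(2, -1), (6, 3), (8, 1), (24, -3)]))
  have hYd := UpperHalfPlane.mdifferentiable_iff.mp
    (mdifferentiable_etaQuotient 24 (expFn [(2, -1), (4, 1), (6, -1), (8, 2), (12, 5), (24, -6)]))
  have hderiv : ∀ z ∈ {z : ℂ | 0 < z.im}, deriv (fun z : ℂ ↦ (X ∘ ofComplex) z ^ 3 - (X ∘ ofComplex) z ^ 2
      - 4 * (X ∘ ofComplex) z + 4 - (Y ∘ ofComplex) z ^ 2) z = 0 := by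
    intro z hz
    have h1 : HasDerivAt (X ∘ ofComplex) (deriv (X ∘ ofComplex) z) z :=
      ((hXd z hz).differentiableAt (isOpen_upperHalfPlaneSet.mem_nhds hz)).hasDerivAt
    have h2 : HasDerivAt (Y ∘ ofComplex) (deriv (Y ∘ ofComplex) z) z :=
      ((hYd z hz).differentiableAt (isOpen_upperHalfPlaneSet.mem_nhds hz)).hasDerivAt
    have hPd := ((((h1.pow 3).sub (h1.pow 2)).sub (h1.const_mul 4)).add_const (4 : ℂ)).sub (h2.pow 2)
    have hfun : (fun z : ℂ ↦ (X ∘ ofComplex) z ^ 3 - (X ∘ ofComplex) z ^ 2 - 4 * (X ∘ ofComplex) z + 4 - (Y ∘ ofComplex) z ^ 2)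
        = ((fun w ↦ ((X ∘ ofComplex ^ 3 - X ∘ ofComplex ^ 2) - fun v ↦ 4 * (X ∘ ofComplex) v) w + 4) - Y ∘ ofComplex ^ 2) := by
      funext w
      simp only [Pi.sub_apply, Pi.pow_apply]
    rw [hfun, hPd.deriv]
    have hx' := hx ⟨z, hz⟩
    have hy' := hy ⟨z, hz⟩
    have hcoe : ((⟨z, hz⟩ : ℍ) : ℂ) = z := rfl
    rw [hcoe] at hx' hy'
    simp only [Function.comp_apply, ofComplex_apply_of_im_pos hz]
    rw [hx', hy', show (3 : ℕ) - 1 = 2 from rfl, show (2 : ℕ) - 1 = 1 from rfl]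
    push_cast
    ring
  have hPdiff : DifferentiableOn ℂ (fun z : ℂ ↦ (X ∘ ofComplex) z ^ 3 - (X ∘ ofComplex) z ^ 2
      - 4 * (X ∘ ofComplex) z + 4 - (Y ∘ ofComplex) z ^ 2) {z : ℂ | 0 < z.im} :=
    ((((hXd.pow 3).sub (hXd.pow 2)).sub (hXd.const_mul 4)).add_const (4 : ℂ)).sub (hYd.pow 2)
  have hconst : ∀ z ∈ {z : ℂ | 0 < z.im}, ∀ w ∈ {z : ℂ | 0 < z.im},
      (fun z : ℂ ↦ (X ∘ ofComplex) z ^ 3 - (X ∘ ofComplex) z ^ 2 - 4 * (X ∘ ofComplex) z + 4 - (Y ∘ ofComplex) z ^ 2) z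
        = (fun z : ℂ ↦ (X ∘ ofComplex) z ^ 3 - (X ∘ ofComplex) z ^ 2 - 4 * (X ∘ ofComplex) z + 4 - (Y ∘ ofComplex) z ^ 2) w :=
    fun z hz w hw ↦ isOpen_upperHalfPlaneSet.is_const_of_deriv_eq_zero
      convex_setOf_im_pos.isPreconnected hPdiff hderiv hz hw
  intro τ
  have hlim : Tendsto (fun σ : ℍ ↦ X σ ^ 3 - X σ ^ 2 - 4 * X σ + 4 - Y σ ^ 2) atImInfty
      (𝓝 (X τ ^ 3 - X τ ^ 2 - 4 * X τ + 4 - Y τ ^ 2)) := by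
    refine tendsto_const_nhds.congr fun σ ↦ ?_
    have h := hconst _ τ.im_pos _ σ.im_pos
    simp only [Function.comp_apply, ofComplex_apply] at h
    exact h
  have h0 : X τ ^ 3 - X τ ^ 2 - 4 * X τ + 4 - Y τ ^ 2 = 0 := tendsto_nhds_unique hlim hT3
  linear_combination h0

/-- `x · q² → 1` at `i∞`. [folklore] -/
theorem tendsto_x24_mul_qParam_sq :
    Tendsto (fun τ : ℍ ↦ etaQuotient 24 (expFn [(2, -1), (6, 3), (8, 1), (24, -3)]) τ
      * Function.Periodic.qParam 1 (τ : ℂ) ^ (2 : ℤ)) atImInfty (𝓝 1) := by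
  have h := tendsto_etaQuotient_div_qParam_zpow 24 (expFn [(2, -1), (6, 3), (8, 1), (24, -3)]) (-2) (by decide)
  refine h.congr fun τ ↦ ?_
  rw [zpow_neg, div_inv_eq_mul]

/-- Non-degeneracy on the shifted coordinate `X = x − ⅓`: `4X³ − (52/3)X + 280/27 = 4y²`... is not identically `0`
(else `(x q²)³ → 1` contradicts `x³ = x² + 4x − 4 + lower`, i.e. `x³q⁶ = (x² + 4x − 4)q⁶ → 0`). [folklore] -/
theorem exists_x24_nondegenerate :
    ∃ τ₀ : ℍ, 4 * (etaQuotient 24 (expFn [(2, -1), (6, 3), (8, 1), (24, -3)]) τ₀ - 1 / 3) ^ 3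
      - 52 / 3 * (etaQuotient 24 (expFn [(2, -1), (6, 3), (8, 1), (24, -3)]) τ₀ - 1 / 3) - (-(280 / 27)) ≠ 0 := by
  by_contra hne
  push Not at hne
  -- `x³ = x² + 4x − 4` identically
  have hx3 : ∀ τ : ℍ, etaQuotient 24 (expFn [(2, -1), (6, 3), (8, 1), (24, -3)]) τ ^ 3
      = etaQuotient 24 (expFn [(2, -1), (6, 3), (8, 1), (24, -3)]) τ ^ 2
        + 4 * etaQuotient 24 (expFn [(2, -1), (6, 3), (8, 1), (24, -3)]) τ - 4 :=
    fun τ ↦ by linear_combination (1 / 4 : ℂ) * hne τ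
  have hq := tendsto_qParam_zpow_atImInfty (m := 2) (by norm_num)
  have hxq := tendsto_x24_mul_qParam_sq
  -- `x q² → 1`, `q² → 0`: then `x³q⁶ = (xq²)³ → 1` but `(x² + 4x − 4)q⁶ = (xq²)²q² + 4(xq²)q⁴ − 4q⁶ → 0`
  have h1 : Tendsto (fun τ : ℍ ↦ (etaQuotient 24 (expFn [(2, -1), (6, 3), (8, 1), (24, -3)]) τ
      * Function.Periodic.qParam 1 (τ : ℂ) ^ (2 : ℤ)) ^ 3) atImInfty (𝓝 1) := by
    simpa using hxq.pow 3
  have h2 : Tendsto (fun τ : ℍ ↦ (etaQuotient 24 (expFn [(2, -1), (6, 3), (8, 1), (24, -3)]) τ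
      * Function.Periodic.qParam 1 (τ : ℂ) ^ (2 : ℤ)) ^ 3) atImInfty (𝓝 0) := by
    have h := ((hxq.pow 2).mul hq).add ((((hxq.const_mul 4).mul hq).mul hq).sub ((hq.mul hq).mul hq |>.const_mul 4))
    simp only [one_pow, mul_zero, sub_zero, add_zero] at h
    refine h.congr fun τ ↦ ?_
    rw [mul_pow _ _ 3, hx3]
    ring
  exact one_ne_zero (tendsto_nhds_unique h1 h2)

/-- **(S2)₂₄ from the two identities (I1), (I2a)**: the period lattice of `φ₂₄` lies in the lattice of the Weierstrass pair with invariants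
`g₂ = 52/3 = c₄(24a1)/12`, `g₃ = −280/27 = c₆(24a1)/216` (analytic bridge on `X = x − ⅓`: `(X′)² = (2πiφ₂₄)²(4X³ − g₂X − g₃)`).
[cite: CremonaAlgorithms1997, §2.10, Table 1 (24a1)] -/
theorem periodLatticeLe24_of_etaIdentities
    (h1 : ∀ τ : ℍ, etaQuotient 24 (expFn [(2, -1), (6, 3), (8, 1), (24, -3)]) τ ^ 3
      - etaQuotient 24 (expFn [(2, -1), (6, 3), (8, 1), (24, -3)]) τ ^ 2
      - 4 * etaQuotient 24 (expFn [(2, -1), (6, 3), (8, 1), (24, -3)]) τ + 4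
      = etaQuotient 24 (expFn [(2, -1), (4, 1), (6, -1), (8, 2), (12, 5), (24, -6)]) τ ^ 2)
    (h2 : ∀ τ : ℍ, deriv (etaQuotient 24 (expFn [(2, -1), (6, 3), (8, 1), (24, -3)]) ∘ ofComplex) τ
      = -(2 * π * I * cuspFormEta24 τ)
          * (2 * etaQuotient 24 (expFn [(2, -1), (4, 1), (6, -1), (8, 2), (12, 5), (24, -6)]) τ)) :
    ∃ L₁ : PeriodPair, L₁.g₂ = 52 / 3 ∧ L₁.g₃ = -(280 / 27) ∧
      ∀ z ∈ periodLattice cuspFormEta24, z ∈ L₁.lattice := by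
  obtain ⟨L₁, hg2, hg3⟩ := PeriodPair.uniformization_holds (52 / 3) (-(280 / 27)) (by norm_num)
  have hmd : MDifferentiable 𝓘(ℂ) 𝓘(ℂ) (fun τ : ℍ ↦ etaQuotient 24 (expFn [(2, -1), (6, 3), (8, 1), (24, -3)]) τ - 1 / 3) :=
    (mdifferentiable_etaQuotient 24 _).sub mdifferentiable_const
  refine ⟨L₁, hg2, hg3, periodLattice_le_of_deriv_sq cuspFormEta24 cuspFormEta24_ne_zero L₁ _ hmd
    (fun γ τ ↦ by simp only [x24_smul γ τ]) ?_ (by rw [hg2, hg3]; exact exists_x24_nondegenerate)⟩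
  intro τ
  have hderiv : deriv ((fun σ : ℍ ↦ etaQuotient 24 (expFn [(2, -1), (6, 3), (8, 1), (24, -3)]) σ - 1 / 3) ∘ ofComplex) τ
      = deriv (etaQuotient 24 (expFn [(2, -1), (6, 3), (8, 1), (24, -3)]) ∘ ofComplex) τ := by
    rw [show ((fun σ : ℍ ↦ etaQuotient 24 (expFn [(2, -1), (6, 3), (8, 1), (24, -3)]) σ - 1 / 3) ∘ ofComplex)
      = fun z ↦ (etaQuotient 24 (expFn [(2, -1), (6, 3), (8, 1), (24, -3)]) ∘ ofComplex) z - 1 / 3 from rfl, deriv_sub_const]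
  rw [hderiv, h2 τ, hg2, hg3]
  linear_combination 4 * (2 * π * I * cuspFormEta24 τ) ^ 2 * (h1 τ).symm

end Summit.BirchSwinnertonDyer.BirchSwinnertonDyer.Theorems.ManinLocalTwoThree.EtaIdentityReductionTwentyFour

end
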